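import Mathlib.RingTheory.Finiteness.Basic
import Literature.NumberTheory.EllipticCurves.Isogeny
import HarnessLib

/-!
# `Hom_K(E, E')` as a `ℤ`-module: group structure, factoring through `[m]`, lemma of *AEC* III.7.4

Trunk T-ELLARITH (group G16); notion `cm_endomorphisms_isogeny`. Serves the named fact
`Literature.AlgebraicGeometry.Motives.linearIndependent_tateModule_map` of `Literature.AlgebraicGeometry.Motives.FaltingsEC`
(Silverman, *AEC*, Thm. III.7.4: `Hom(E₁, E₂) ⊗ ℤ_ℓ → Hom(T_ℓ E₁, T_ℓ E₂)` is injective), whose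
printed proof (III.§7) uses exactly the three inputs vendored here.

## Contents

* `WeierstrassCurve.homModule W W'`: the group `Hom_K(E, E')` of isogenies `E → E'` defined over
  `K` together with `0`, realised as the `ℤ`-span, inside the group `Hom(E(K̄), E'(K̄))` of additive
  maps on geometric points, of the maps underlying the isogenies `Isogeny W W'` of the prelude
  `Literature.NumberTheory.EllipticCurves.Isogeny` (a real definition), with its elementary API.
* `Literature.divHull N M`: for `ℤ`-submodules `M, N` of an abelian group, the submodule
  `{f ∈ N | m • f ∈ M for some integer m ≥ 1}` (Silverman's `M^div` in the proof of *AEC*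
  Thm. III.7.4, for `N = Hom(E₁, E₂)`), a real definition with its API.
* Named facts (`def … : Prop`, D-0014), each quantifying `[W.IsElliptic] [W'.IsElliptic]` in its
  body:
  * `WeierstrassCurve.mem_homModule_iff`: `Hom_K(E, E')` *is* `{0} ∪ {isogenies}`, i.e. sums and
    negatives of isogenies are isogenies or zero (*AEC* III.§4, the paragraph introducing
    `Hom(E₁, E₂)` before Example III.4.1, from Thm. III.3.6);
  * `WeierstrassCurve.Isogeny.exists_eq_comp_nsmul_of_geomTorsion_le_ker`: an isogeny killing
    `E[m]`, `m ≠ 0` in `K`, factors as `λ ∘ [m]` (*AEC* Cor. III.4.11 applied to the separable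
    isogeny `[m]`, Cor. III.5.4);
  * `WeierstrassCurve.fg_divHull_homModule`: for `M ⊆ Hom_K(E, E')` finitely generated,
    `M^div = {φ | mφ ∈ M for some m ≥ 1}` is finitely generated (the statement `(*)` in the proof
    of *AEC* Thm. III.7.4, proved there from the positive definite quadratic form `deg`,
    Cor. III.6.3, and torsion-freeness of `Hom`, Prop. III.4.2(b)).

## Faithfulness of the encoding

In the prelude an isogeny over `K` is recorded by its (algebraic, `Γ_K`-equivariant, finite-kernel)
homomorphism on `K̄`-points; a morphism of curves is determined by its `K̄`-points and, conversely,
an additive map agreeing with a rational map off a finite set is the map on points of the morphism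
extending it (*AEC* II.2.1, III.4.8), so `Isogeny W W'` is in bijection with the non-zero elements
of Silverman's `Hom_K(E, E')`, compatibly with pointwise addition. Hence `homModule W W'` is the
image of `Hom_K(E, E')` in `Hom(E(K̄), E'(K̄))` and the three facts are the cited printed
statements read through this dictionary: for III.4.11 the isogeny `λ` with `ψ = λ ∘ [m]` is
unique, hence `Γ_K`-equivariant when `ψ` is (equivalently: `[m]` is onto `E(K̄)`, *AEC* II.2.3), so
it is again an `Isogeny W W'`; for `(*)` one has `M^div ∩ Hom_K ⊆ M^div`, a subgroup of a finitely
generated abelian group. Silverman's standing hypothesis "`K` perfect" (*AEC* Ch. I, notation)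
is immaterial here: all three statements concern `K̄`-points and equivariance under `Aut(K̄/K)`.

## Mathlib

Mathlib has no isogenies (see the prelude `Isogeny`); it has `Submodule.span`, `Submodule.FG`,
`AddSubgroup.torsionBy` (used through `geomTorsion`), and no "divisible hull / saturation" of a
submodule (only the predicate `AddSubmonoid.NSMulSaturated`), whence `Literature.NumberTheory.EllipticCurves.divHull`.

## References

* [SilvermanAEC2009] J. H. Silverman, *The Arithmetic of Elliptic Curves*, 2nd ed., GTM 106,
  Springer 2009: III.§4 (pp. 66 ff.: the group `Hom(E₁, E₂)`, Prop. III.4.2(b), Thm. III.4.8,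
  Cor. III.4.11), III.§5 (Cor. III.5.4), III.§7 (pp. 87 ff.: Thm. III.7.4 and the statement `(*)`
  in its proof). Page numbers are those of the printed 2nd edition's table of contents.

## Design choices

* `noncomputable section`, `open scoped Classical`, base field `K : Type u` in a named universe
  (as in the preludes). Curve-specific declarations are deliberate dot-notation extensions in
  `namespace WeierstrassCurve`; the generic `divHull` lives in `namespace Literature`.
* `Hom_K(E, E')` is a `ℤ`-submodule (not an `AddSubgroup`) because its consumers speak of
  `LinearIndependent ℤ`, `Submodule.span ℤ` and `Submodule.FG`.
* In `divHull` the multiplier is an integer `m` with `0 < m` ("some integer `m ≥ 1`", *AEC*, proof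
  of Thm. III.7.4).
-/

noncomputable section

open scoped Classical

universe u v

/-! ## The divisible hull `M^div` of a submodule -/

namespace Literature.NumberTheory.EllipticCurves

section DivHull

variable {V : Type v} [AddCommGroup V] (N M : Submodule ℤ V)

/-- The *divisible hull of `M` inside `N`*: for `ℤ`-submodules `M, N` of an abelian group `V`, the
submodule `{f ∈ N | m • f ∈ M for some integer m ≥ 1}` of elements of `N` having a positive multiple
in `M`. For `N = Hom(E₁, E₂)` and `M ⊆ N` this is Silverman's `M^div`.
Silverman, *AEC*, proof of Thm. III.7.4. [folklore] -/
def divHull : Submodule ℤ V where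
  carrier := {f | f ∈ N ∧ ∃ m : ℤ, 0 < m ∧ m • f ∈ M}
  zero_mem' := ⟨N.zero_mem, 1, one_pos, by rw [smul_zero]; exact M.zero_mem⟩
  add_mem' := by
    rintro f g ⟨hf, m, hm, hmf⟩ ⟨hg, m', hm', hmg⟩
    refine ⟨N.add_mem hf hg, m * m', mul_pos hm hm', ?_⟩
    rw [smul_add, mul_comm m m', mul_smul, mul_comm m' m, mul_smul]
    exact M.add_mem (M.smul_mem m' hmf) (M.smul_mem m hmg)
  smul_mem' := by
    rintro c f ⟨hf, m, hm, hmf⟩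
    exact ⟨N.smul_mem c hf, m, hm, by rw [smul_comm]; exact M.smul_mem c hmf⟩

variable {N M}

/-- Membership in `divHull N M`. [folklore] -/
theorem mem_divHull_iff {f : V} :
    f ∈ divHull N M ↔ f ∈ N ∧ ∃ m : ℤ, 0 < m ∧ m • f ∈ M :=
  Iff.rfl

variable (N M) in
/-- `M^div ⊆ N`. [folklore] -/
theorem divHull_le : divHull N M ≤ N :=
  fun _ hf ↦ hf.1

/-- `M ⊆ M^div` when `M ⊆ N` (take `m = 1`). [folklore] -/
theorem le_divHull (h : M ≤ N) : M ≤ divHull N M :=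
  fun _ hf ↦ ⟨h hf, 1, one_pos, by rwa [one_smul]⟩

/-- If `f ∈ N` and `m • f ∈ M` for some `m ≥ 1`, then `f ∈ M^div`. [folklore] -/
theorem mem_divHull_of_smul_mem {f : V} (hf : f ∈ N) {m : ℤ} (hm : 0 < m) (hmf : m • f ∈ M) :
    f ∈ divHull N M :=
  ⟨hf, m, hm, hmf⟩

end DivHull

end Literature.NumberTheory.EllipticCurves

/-! ## `Hom_K(E, E')` inside `Hom(E(K̄), E'(K̄))` -/

namespace WeierstrassCurve

open Literature.NumberTheory.EllipticCurves

variable {K : Type u} [Field K] (W W' : WeierstrassCurve K)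

/-- The group `Hom_K(E, E')` of isogenies `E → E'` defined over `K`, together with the zero map,
realised inside the group `Hom(E(K̄), E'(K̄))` of additive maps on geometric points as the `ℤ`-span
of the homomorphisms underlying the isogenies `Isogeny W W'`. By `mem_homModule_iff` (Silverman:
"`Hom(E₁, E₂)` is a group") this span adds only `0` to the set of isogenies.
Silverman, *AEC*, III.§4 (`Hom(E₁, E₂)`, `Hom_K(E₁, E₂)`, before Example III.4.1).
[cite: SilvermanAEC2009, III.§4 (the groups Hom(E₁, E₂), Hom_K(E₁, E₂))] -/
def homModule : Submodule ℤ (W.geomPoints →+ W'.geomPoints) :=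
  Submodule.span ℤ
    (Set.range (Isogeny.toAddMonoidHom : Isogeny W W' → W.geomPoints →+ W'.geomPoints))

variable {W W'}

/-- The homomorphism underlying an isogeny over `K` lies in `Hom_K(E, E')`.
Silverman, *AEC*, III.§4. [folklore] -/
theorem Isogeny.toAddMonoidHom_mem_homModule (φ : Isogeny W W') :
    φ.toAddMonoidHom ∈ homModule W W' :=
  Submodule.subset_span ⟨φ, rfl⟩

/-- The `ℤ`-span of any family of isogenies over `K` is contained in `Hom_K(E, E')`. [folklore] -/
theorem span_range_toAddMonoidHom_le_homModule {ι : Type*} (φ : ι → Isogeny W W') :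
    Submodule.span ℤ (Set.range fun i ↦ (φ i).toAddMonoidHom) ≤ homModule W W' :=
  Submodule.span_le.mpr (by rintro _ ⟨i, rfl⟩; exact (φ i).toAddMonoidHom_mem_homModule)

/-- The easy half of `mem_homModule_iff`: `0` and the isogenies lie in `Hom_K(E, E')`. [folklore] -/
theorem mem_homModule_of_eq_zero_or_exists {f : W.geomPoints →+ W'.geomPoints}
    (h : f = 0 ∨ ∃ φ : Isogeny W W', φ.toAddMonoidHom = f) : f ∈ homModule W W' := by
  rcases h with rfl | ⟨φ, rfl⟩
  exacts [Submodule.zero_mem _, φ.toAddMonoidHom_mem_homModule]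

variable (W W')

/-- **`Hom_K(E, E')` is a group** (named fact): for elliptic curves `E, E'` over `K`, an additive
map `E(K̄) → E'(K̄)` lies in the `ℤ`-span `homModule W W'` of the isogenies over `K` if and only if
it is `0` or (the map on points of) an isogeny over `K`; i.e. sums and negatives of isogenies are
again isogenies or zero. Silverman: "(III.3.6) implies that `φ + ψ` is a morphism, so it is an
isogeny. Hence `Hom(E₁, E₂)` is a group"; the `K`-rational ones form the subgroup `Hom_K(E₁, E₂)`.
Silverman, *AEC*, III.§4, the paragraph introducing `Hom(E₁, E₂)` before Example III.4.1 (with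
Thm. III.3.6 and Thm. III.4.8). [cite: SilvermanAEC2009, III.§4 (Hom(E₁, E₂) is a group)] -/
def mem_homModule_iff : Prop :=
  ∀ [W.IsElliptic] [W'.IsElliptic] (f : W.geomPoints →+ W'.geomPoints),
    f ∈ homModule W W' ↔ f = 0 ∨ ∃ φ : Isogeny W W', φ.toAddMonoidHom = f

/-- **Isogenies killing `E[m]` factor through `[m]`** (named fact): let `E, E'` be elliptic curves
over `K`, `m` an integer with `m ≠ 0` in `K`, and `ψ : E → E'` an isogeny over `K` with
`E[m] ⊆ ker ψ` (on `K̄`-points). Then there is an isogeny `λ : E → E'` over `K` with `ψ = λ ∘ [m]`.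
This is Silverman, *AEC*, Cor. III.4.11 (`φ, ψ` non-constant isogenies, `φ` separable,
`ker φ ⊆ ker ψ` ⟹ `∃! λ, ψ = λ ∘ φ`) applied to `φ = [m]`, which is separable because `m ≠ 0` in `K`
(Cor. III.5.4); `λ` is defined over `K` (i.e. `Γ_K`-equivariant on `K̄`-points) by uniqueness,
equivalently because `[m]` maps `E(K̄)` onto itself (II.2.3).
[cite: SilvermanAEC2009, Cor. III.4.11 with Cor. III.5.4] -/
def Isogeny.exists_eq_comp_nsmul_of_geomTorsion_le_ker : Prop :=
  ∀ [W.IsElliptic] [W'.IsElliptic] {m : ℕ}, (m : K) ≠ 0 → ∀ ψ : Isogeny W W',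
    (∀ P ∈ geomTorsion W m, ψ P = 0) → ∃ lam : Isogeny W W', ∀ P, ψ P = lam (m • P)

/-- **The lemma `(*)` of *AEC* III.7.4** (named fact): for elliptic curves `E, E'` over `K` and a
finitely generated subgroup `M ⊆ Hom_K(E, E')`, the subgroup
`M^div = {φ ∈ Hom_K(E, E') | [m] ∘ φ ∈ M for some integer m ≥ 1}` is finitely generated.
Silverman proves this for `Hom(E₁, E₂)` (isogenies over `K̄`) using that `deg` is a positive
definite quadratic form (Cor. III.6.3) and that `Hom(E₁, E₂)` is torsion-free (Prop. III.4.2(b)):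
`M^div` is a discrete subgroup of `M ⊗ ℝ`. The `K`-rational version stated here is its subgroup
`M^div ∩ Hom_K(E, E')`. Silverman, *AEC*, statement `(*)` in the proof of Thm. III.7.4 (III.§7).
[cite: SilvermanAEC2009, Thm. III.7.4, proof, statement (*)] -/
def fg_divHull_homModule : Prop :=
  ∀ [W.IsElliptic] [W'.IsElliptic] (M : Submodule ℤ (W.geomPoints →+ W'.geomPoints)),
    M ≤ homModule W W' → M.FG → (divHull (homModule W W') M).FG

end WeierstrassCurve
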